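import Summits.CriticalPhenomena.PercolationContinuityZ3.Theorems.PercNearOneGluingNoHeavyQuantGatedShiftPartial
import HarnessLib

/-!
# QUANT lane R8, T-DEC, cell L2 (`LawDec.SGCLightPair`), part 1a: the two rate inequalities of the two-copy construction

builds on p205010 (kernel theorem, internal audit signed; external expert review pending)

Support file (`--supports stmt-CriticalPhenomena-4575`), QUANT lane seat prim-quant-arm-2 (gen 37), rung R8 of
`run/shared/lean/prim/quant/LADDER.md`.  Theorems only, standard axioms, no sorries.  Memo
`run/shared/lean/prim/quant/prim-quant-arm-2-g37/L2-TRANSPORT-G37.md`.  The cell `SGCLightPair` (typer g30) is proved in parts 1a, 1b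
(`…SGCLightPairPieces`), 2 (`…Partial`, `…PartialLo`), 3 (`…Remainder`), 4 (`…Layer`) and `…SGCLightPairHolds` by typer g26's one-layer
gated-shift construction run from TWO source layers with pooled slots; this file holds the two rate facts that make the transport work:
shifted pairs are cheaper when the target rises by at most twice the shift (typer g25's `usage_shift_le`, additive form), and — the new
point — a displaced low `t` with `2t ≥ Δ` rides the image of a zero-compatible mid of EITHER copy at most at the rate the gate zero paid.

* `usage_copy_le` — `usage y (S+Δ) (J+s) (a+s) (m+s) ≤ usage y S J a m` for `Δ ≤ 2s`.
* `usage_slot_le_shift` — `usage y (S+Δ) (J+s) t (m+s) ≤ usage y S J 0 m` for `S < m ≤ J`, `Δ ≤ 2t`, `Δ ≤ 2s`, `2t < S+Δ`.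
* `sum_ite_shift_range` — bookkeeping `Σ_{k ≤ N} [s ≤ k]·g(k−s) = Σ_{i ≤ N−s} g i`; `slot_term_le`, `usage_zero_mid_nonneg` — pooled-slot bookkeeping.

[this work]; rates: this lane (typer g22/g25).  The gluing rows served [cite: KozmaNitzan2024, Conjecture 3 (p. 15)]; product measure
[cite: Grimmett1999, §1.3 p. 10].
-/

noncomputable section

namespace Summit.CriticalPhenomena.PercolationContinuityZ3.Theorems

namespace Quant

open Finset

namespace LawDec

/-! ### Rates -/

/-- **shifted pairs are cheaper** (typer g25's `usage_shift_le` with the increment written additively): for a `ν₁`-admissible pair `(a, m)` at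
`(y, S, J)` and a shift `s ≥ 1` with target increment `Δ ≤ 2s`, `usage y (S+Δ) (J+s) (a+s) (m+s) ≤ usage y S J a m`. [this work] -/
theorem usage_copy_le (y S Δ : ℝ) (J s a m : ℕ) (hy0 : 0 < y) (hy1 : y < 1) (hs : 1 ≤ s) (hΔs : Δ ≤ 2 * (s : ℝ))
    (hlow : 2 * (a : ℝ) < S) (hlt : a < m) (hadm : J + 1 ≤ m ∨ S < (a : ℝ) + m) :
    usage y (S + Δ) (J + s) (a + s) (m + s) ≤ usage y S J a m := by
  have hs0 : (0 : ℝ) < s := by exact_mod_cast (show 0 < s by omega)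
  have e : S + Δ = S + Δ / s * s := by field_simp
  rw [e]
  exact usage_shift_le y S (Δ / s) J s a m hy0 hy1 (by rw [div_le_iff₀ hs0]; linarith) hlow hlt hadm

/-- **pooled slots are cheaper for every displaced low**: target `S ↦ S + Δ`, layer `J ↦ J + s`; a low `t` of the new target with `2t ≥ Δ`
rides the image `m + s` of a mid `m ≤ J` compatible with the gate zero (`S < m`) at most at the rate the gate zero paid for `m` — for ANY
shift `s` with `2s ≥ Δ` (so a low of one copy may use the slots of the other). [this work] -/
theorem usage_slot_le_shift (y S Δ : ℝ) (J s t m : ℕ) (hy0 : 0 < y) (hy1 : y < 1) (hS : 0 < S) (hSm : S < (m : ℝ))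
    (hmJ : m ≤ J) (hΔt : Δ ≤ 2 * (t : ℝ)) (hΔs : Δ ≤ 2 * (s : ℝ)) (htlow : 2 * (t : ℝ) < S + Δ) :
    usage y (S + Δ) (J + s) t (m + s) ≤ usage y S J 0 m := by
  have hng1 : ¬ (J + s + 1 ≤ m + s) := by omega
  have hng2 : ¬ (J + 1 ≤ m) := by omega
  simp only [usage, gateOf, if_neg hng1, if_neg hng2]
  have hm0 : (0 : ℝ) < m := lt_trans hS hSm
  have ht0 : (0 : ℝ) ≤ t := Nat.cast_nonneg t
  have hs0 : (0 : ℝ) ≤ s := Nat.cast_nonneg s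
  have hd : (0 : ℝ) < ((m + s : ℕ) : ℝ) - t := by push_cast; nlinarith
  have hρ : (S + Δ - 2 * (t : ℝ)) / (((m + s : ℕ) : ℝ) - t) ≤ (S - 2 * ((0 : ℕ) : ℝ)) / ((m : ℝ) - ((0 : ℕ) : ℝ)) := by
    rw [div_le_div_iff₀ hd (by simpa using hm0)]
    push_cast
    simp only [mul_zero, sub_zero]
    nlinarith [mul_nonneg (show (0 : ℝ) ≤ (m : ℝ) - S by linarith) (show (0 : ℝ) ≤ 2 * (t : ℝ) - Δ by linarith),
      mul_nonneg hS.le (show (0 : ℝ) ≤ (s : ℝ) + t - Δ by linarith)]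
  have hlt1 := pairGate_lt_one y S 0 m hy0 hy1 (by simpa using hS) (by simpa using hSm)
  have mono : ∀ {a b : ℝ}, a ≤ b → b < 1 → a / (1 - a) ≤ b / (1 - b) := by
    intro a b hab hb
    have ha : 0 < 1 - a := by linarith
    have hb' : 0 < 1 - b := by linarith
    rw [div_le_div_iff₀ ha hb']
    nlinarith
  exact mono (pairGate_mono_rho y _ _ _ _ _ _ hy1.le hρ) hlt1

/-- bookkeeping: `Σ_{k < N+1} [s ≤ k]·g (k − s) = Σ_{i < N+1−s} g i` (`s ≤ N + 1`). [folklore] -/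
theorem sum_ite_shift_range (g : ℕ → ℝ) (s N : ℕ) (_hs : s ≤ N + 1) :
    ∑ k ∈ Finset.range (N + 1), (if s ≤ k then g (k - s) else 0) = ∑ i ∈ Finset.range (N + 1 - s), g i := by
  rw [sum_range_ite_ge_eq_Ico, Finset.sum_Ico_eq_sum_range]
  exact Finset.sum_congr rfl fun i _ => by rw [Nat.add_sub_cancel_left]


/-- **pooled slot bookkeeping**: if the weights `ρ ≥ 0` sum to at most `1` over the lows and every charged low `t` (`P t`, `ρ t > 0`) rides
the column `k` at rate `≤ u₀`, then the slot terms `usage(t,k)·[P t]·ρ t·s_k` of column `k` add up to at most `u₀·s_k`. [this work] -/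
theorem slot_term_le (y S' u0 sk : ℝ) (j k : ℕ) (ρ : ℕ → ℝ) (P : ℕ → Prop) [DecidablePred P]
    (hρ0 : ∀ t, 0 ≤ ρ t) (hρ1 : ∑ t ∈ Finset.range (j + 1), ρ t ≤ 1) (hsk : 0 ≤ sk) (hu0 : 0 ≤ u0)
    (hrate : ∀ t, P t → 0 < ρ t → usage y S' j t k ≤ u0) :
    ∑ t ∈ Finset.range (j + 1), usage y S' j t k * (if P t then ρ t * sk else 0) ≤ u0 * sk := by
  have hbd : ∀ t ∈ Finset.range (j + 1), usage y S' j t k * (if P t then ρ t * sk else 0) ≤ ρ t * (u0 * sk) := by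
    intro t _
    by_cases ht : P t
    · rw [if_pos ht]
      rcases (hρ0 t).eq_or_lt with hz | hp
      · rw [← hz]; simp
      · calc usage y S' j t k * (ρ t * sk) = ρ t * (usage y S' j t k * sk) := by ring
          _ ≤ ρ t * (u0 * sk) := mul_le_mul_of_nonneg_left (mul_le_mul_of_nonneg_right (hrate t ht hp) hsk) hp.le
    · rw [if_neg ht, mul_zero]; exact mul_nonneg (hρ0 t) (mul_nonneg hu0 hsk)
  calc ∑ t ∈ Finset.range (j + 1), usage y S' j t k * (if P t then ρ t * sk else 0)
      ≤ ∑ t ∈ Finset.range (j + 1), ρ t * (u0 * sk) := Finset.sum_le_sum hbd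
    _ = (∑ t ∈ Finset.range (j + 1), ρ t) * (u0 * sk) := by rw [Finset.sum_mul]
    _ ≤ 1 * (u0 * sk) := mul_le_mul_of_nonneg_right hρ1 (mul_nonneg hu0 hsk)
    _ = u0 * sk := one_mul _

/-- the gate zero's rate at a compatible mid of the source frame is nonnegative. [this work] -/
theorem usage_zero_mid_nonneg (y S : ℝ) (J m : ℕ) (hy0 : 0 < y) (hy1 : y < 1) (hS : 0 < S) (hSm : S < (m : ℝ)) (hmJ : m ≤ J) :
    0 ≤ usage y S J 0 m := by
  have hng : ¬ (J + 1 ≤ m) := by omega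
  have hG0 := pairGate_pos y S 0 m (by simpa using hS) (by exact_mod_cast (lt_trans hS hSm : (0:ℝ) < m))
  have hG1 := pairGate_lt_one y S 0 m hy0 hy1 (by simpa using hS) (by simpa using hSm)
  simp only [usage, gateOf, if_neg hng]
  exact div_nonneg hG0.le (by linarith)

end LawDec

end Quant

end Summit.CriticalPhenomena.PercolationContinuityZ3.Theorems
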